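/-
Origin: expansion seat `planner-pub-hodgecm-pv14-g4-0`, handover #5 2026-08-18T09:03:17Z (`HOME/pub-hodgecm-pv14-g4/lean/Pv14g4/SchwartzWeilKerSpan.lean`, md5 ac2a415d, 67 lines);
landed by the gen-7 packager in gate run 27 as `HodgeCM/PerL34/SchwartzWeilKerSpan.lean` (import ^import Pv14g4\.→import HodgeCM.Automorphic. ×1; import ^import Pv[0-9]+g[0-9]+\.→import HodgeCM.PerL34. ×1).
-/
/-
Origin: HOME/pub-hodgecm-pv14-g4/lean/Pv14g4/SchwartzWeilKerSpan.lean — session planner-pub-hodgecm-pv14-g4-0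
(unit pub-hodgecm-pv14-g4, DAG-NODE PROVER #14 gen 4).
Intended final place (packager's call): `HodgeCM/PerL34/SchwartzWeilKerSpan.lean` (junction of two run-27 leaves).
NEW ADDITIVE LEAF.  WIP imports ↦ landed names: `Pv14g4.WeilThetaModelSchrodingerLinear` ↦
`HodgeCM.Automorphic.WeilThetaModelSchrodingerLinear` (my HANDOVER #4) and `Pv02g5.ArchAWeil` ↦ `HodgeCM.PerL34.ArchAWeil`
(pv02-g5 HANDOVER #1, f336deb86a0a; my `lean/Pv02g5/ArchAWeil.lean` is a byte MIRROR for local elaboration — DO NOT LAND it).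
Lands AFTER both.  KIND: KERNEL — nothing cited, nothing posited.
-/
import Summits.HodgeConjecture.HodgeCM.Automorphic.WeilThetaModelSchrodingerLinear
import Summits.HodgeConjecture.HodgeCM.PerL34.ArchAWeil_2

/-!
# The kernel span of the Schrödinger–lattice model is the range of `θLinear`

pv02-g5's N27 bridge works on the KERNEL side `kerSpan M := span ℂ (range M.θ) ⊆ C([G_U] × [U(W)], ℂ)` of a
`WeilThetaModel M` (the carrier `SK` of a general model has no linear structure).  For the Schrödinger–lattice model
(`SK = univ ⊆ 𝓢(E, ℂ)`, `Φ ↦ θ_Φ` `ℂ`-linear: pv14-g4 #4 `θLinear`) the span is superfluous: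
**`kerSpan (schrodingerModel E L m Γ hΓ) = LinearMap.range (θLinear E L m Γ hΓ)`** (`kerSpan_schrodinger`), i.e.
every element of the kernel span is ONE kernel `θ_Φ`, `Φ ∈ 𝓢(E, ℂ)` (`mem_kerSpan_schrodinger_iff`).  This lets
`orbitSpan` / `OrbitFinite` (pv02-g5 #2) be read on `𝓢(E, ℂ)` directly (suggested by pv02-g5, STATUS 08:51:16Z).
-/

set_option autoImplicit false

noncomputable section

open scoped SchwartzMap

namespace HodgeCM
namespace SchwartzWeil

variable (E : Type) [NormedAddCommGroup E] [NormedSpace ℝ E] [FiniteDimensional ℝ E]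
  (L : Submodule ℤ E) [DiscreteTopology L] (m : ℤ) (Γ : Subgroup Circle) (hΓ : ∀ u ∈ Γ, u ^ m = 1)

/-- Every element of `SK = univ` is `toSK` of its underlying Schwartz function. -/
theorem toSK_val (Φ : (schrodingerModel E L m Γ hΓ).SK) : toSK E L m Γ hΓ Φ.1 = Φ :=
  Subtype.ext rfl

/-- The range of prl1-g4's kernel map `θ` on the model is the range of the linear map `θLinear`. -/
theorem range_θ_schrodinger :
    Set.range (schrodingerModel E L m Γ hΓ).θ = LinearMap.range (θLinear E L m Γ hΓ) := by
  ext F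
  constructor
  · rintro ⟨Φ, rfl⟩
    exact ⟨Φ.1, by rw [θLinear_apply, toSK_val]⟩
  · rintro ⟨Φ, rfl⟩
    exact ⟨toSK E L m Γ hΓ Φ, (θLinear_apply E L m Γ hΓ Φ).symm⟩

/-- **`kerSpan = range θLinear`**: the kernel span of the Schrödinger–lattice model is the range of the
`ℂ`-linear kernel map `Φ ↦ θ_Φ` on `𝓢(E, ℂ)` — no span needed. -/
theorem kerSpan_schrodinger :
    PerL34.ArchAWeil.kerSpan (schrodingerModel E L m Γ hΓ) = LinearMap.range (θLinear E L m Γ hΓ) := by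
  unfold PerL34.ArchAWeil.kerSpan
  rw [range_θ_schrodinger, Submodule.span_eq]

/-- Membership form: `F ∈ kerSpan` iff `F = θ_Φ` for some Schwartz function `Φ`. -/
theorem mem_kerSpan_schrodinger_iff (F : C((Multiplicative E ⧸ latticeSubgroup E L) × (Circle ⧸ Γ), ℂ)) :
    F ∈ PerL34.ArchAWeil.kerSpan (schrodingerModel E L m Γ hΓ) ↔
      ∃ Φ : 𝓢(E, ℂ), (schrodingerModel E L m Γ hΓ).θ (toSK E L m Γ hΓ Φ) = F := by
  rw [kerSpan_schrodinger, LinearMap.mem_range]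
  simp only [θLinear_apply]

end SchwartzWeil
end HodgeCM

end
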